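import Mathlib.RingTheory.PowerSeries.WellKnown
import Mathlib.Algebra.Polynomial.BigOperators
import Mathlib.Algebra.Polynomial.Div
import Mathlib.Data.Nat.Choose.Vandermonde
import Mathlib.Data.Nat.Choose.Bounds
import HarnessLib

/-!
# Padé approximants to `(1 - x)ⁿ` (Bombieri–Gubler, *Heights*, Thm. 5.2.10): the polynomial
# `Q_{L,M,N}` and the identity `(1 - x)^{L+N+1} Q_{L,M,N}(x) = P(x) + x^{L+M+1} R(x)`

Bombieri–Gubler, *Heights in Diophantine Geometry*, Thm. 5.2.10 (p. 131): for `L, M, N ≥ 0` the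
polynomial `Q_{L,M,N}(x) = ∑_{j=0}^{M} C(N+j, N) C(L+M-j, L) xʲ ∈ ℤ[x]` of degree `M` admits
`P_{L,M,N}` of degree `L` and `R_{L,M,N}` of degree `N` with
`P_{L,M,N}(x) - (1-x)^{L+N+1} Q_{L,M,N}(x) = x^{L+M+1} R_{L,M,N}(x)`, i.e. `P/Q` is the `(L, M)`
Padé approximant of `(1-x)^{L+N+1}`; these are the explicit Padé approximants behind the
Beukers–Schlickewei bound for the unit equation (B–G Thm. 5.2.1, Lemma 5.2.14).

This file constructs this data **with a self-contained algebraic proof** (B–G prove (5.2) via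
Kummer's transformation of a hypergeometric integral). We show directly:

* `Pade.Q L M N` — the polynomial `Q_{L,M,N}`, as the antidiagonal sum
  `∑_{a+b=M} C(N+a, N) C(L+b, L) xᵃ` (the same polynomial, `b = M - j`);
* `Pade.coeff_F_eq_zero`: the coefficients of `xᵏ` in `F = (1-x)^{L+N+1} Q_{L,M,N}` vanish for
  `L < k ≤ L+M` (**the Padé property**), and
* `Pade.coeff_F_succ`: the coefficient of `x^{L+M+1}` is `(-1)^{L+1} C(L+M+N+1, N)` (so the
  "remainder" `R` has `R(0) ≠ 0`: the approximation has exact order `L+M+1`).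

Proof: `Q_{L,M,N}(x)` is the coefficient of `tᴹ` in `(1 - xt)^{-(N+1)} (1 - t)^{-(L+1)}`
(power series over `ℤ[x]`, Mathlib's `PowerSeries.invOneSubPow` and `PowerSeries.rescale`); write
`1 - x = (1 - xt) - x(1 - t)` and expand `(1-x)^{L+N+1}` binomially: the terms with more than
`N` factors `1 - xt` are polynomials in `t` times `(1-t)^{-k}` and contribute only monomials
`xᵉ`, `e ≤ L`, to the coefficient of `tᴹ`; the others are `(1-xt)^{-k}` times polynomials in
`t` of degree `≤ N - i` and contribute only monomials `xᵉ`, `e ≥ L+M+1`, the extreme one being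
computed by Vandermonde's identity.

From this, `Pade.P` and `Pade.R` are the truncations of `F` (`F = P + x^{L+M+1} R`,
`deg P ≤ L`, `deg R ≤ N`, `Pade.F_eq_P_add`), with the crude coefficient bound
`|coeff| ≤ 2^{2L+M+2N+1}` (`Pade.abs_coeff_F_le`) — single-exponential, which is all the
application needs — and the **non-proportionality lemma** `Pade.not_and_of_consecutive`
replacing B–G Prop. 5.2.11 (Riemann–Hurwitz): `P_L Q_{L-1} - (1-x) P_{L-1} Q_L = c·x^{L+M}`
with `c = R_{L-1}(0) Q_L(0) ≠ 0`, so the two relations used in B–G Lemma 5.2.14 cannot fail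
simultaneously at a point `x₁ ∉ {0}`.

Namespace `Literature.NumberTheory.DiophantineGeometry.Pade` (the object `Q_{L,M,N}` of B–G).

## References

* E. Bombieri, W. Gubler, *Heights in Diophantine Geometry*, CUP 2006, Lemma 5.2.9,
  Thm. 5.2.10, Prop. 5.2.11 (pp. 131–133). [BombieriGubler2006]
* F. Beukers, H. P. Schlickewei, *The equation `x + y = 1` in finitely generated groups*,
  Acta Arith. 78 (1996), 189–199.
-/

noncomputable section

open scoped Classical

open Polynomial Finset

namespace Literature.NumberTheory.DiophantineGeometry

namespace Pade

/-! ## The polynomial `Q_{L,M,N}` -/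

/-- **`Q_{L,M,N}(x) = ∑_{a+b=M} C(N+a, N) C(L+b, L) xᵃ ∈ ℤ[x]`** — Bombieri–Gubler's
`∑_{j=0}^{M} C(N+j, N) C(L+M-j, L) xʲ`, the denominator of the `(L, M)` Padé approximant of
`(1-x)^{L+N+1}` (up to the normalisation of Thm. 5.2.10). [cite: BombieriGubler2006, Thm. 5.2.10] -/
def Q (L M N : ℕ) : ℤ[X] :=
  ∑ p ∈ antidiagonal M, C (((N + p.1).choose N * (L + p.2).choose L : ℕ) : ℤ) * X ^ p.1

/-- `F = (1 - x)^{L+N+1} Q_{L,M,N}(x)`. [cite: BombieriGubler2006, Thm. 5.2.10] -/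
def F (L M N : ℕ) : ℤ[X] :=
  (1 - X) ^ (L + N + 1) * Q L M N

/-- The coefficients of `Q_{L,M,N}`: `C(N+a, N) C(L+M-a, L)` for `a ≤ M`, else `0`. [folklore] -/
theorem coeff_Q (L M N a : ℕ) :
    (Q L M N).coeff a = if a ≤ M then (((N + a).choose N * (L + (M - a)).choose L : ℕ) : ℤ)
      else 0 := by
  simp only [Q, finsetSum_coeff, coeff_C_mul_X_pow]
  rw [Nat.sum_antidiagonal_eq_sum_range_succ_mk]
  simp [Finset.sum_ite_eq]

/-- `Q_{L,M,N}` has degree at most `M`. [folklore] -/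
theorem natDegree_Q_le (L M N : ℕ) : (Q L M N).natDegree ≤ M := by
  refine (natDegree_sum_le _ _).trans (Finset.sup_le fun p hp => ?_)
  exact (natDegree_C_mul_X_pow_le _ _).trans (Finset.HasAntidiagonal.antidiagonal.fst_le hp)

/-- `Q_{L,M,N}(0) = C(L+M, L) ≠ 0`. [folklore] -/
theorem Q_eval_zero (L M N : ℕ) : (Q L M N).eval 0 = ((L + M).choose L : ℤ) := by
  rw [← coeff_zero_eq_eval_zero, coeff_Q]
  simp

/-- The coefficients of `Q_{L,M,N}` are non-negative integers bounded by `2^{L+M+N}`.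
[folklore] -/
theorem abs_coeff_Q_le (L M N a : ℕ) : |(Q L M N).coeff a| ≤ 2 ^ (L + M + N) := by
  rw [coeff_Q]
  split_ifs with h
  · rw [Nat.abs_cast]
    have h1 : (N + a).choose N ≤ 2 ^ (N + a) := Nat.choose_le_two_pow _ _
    have h2 : (L + (M - a)).choose L ≤ 2 ^ (L + (M - a)) := Nat.choose_le_two_pow _ _
    calc (((N + a).choose N * (L + (M - a)).choose L : ℕ) : ℤ)
        ≤ ((2 ^ (N + a) * 2 ^ (L + (M - a)) : ℕ) : ℤ) := by
          exact_mod_cast Nat.mul_le_mul h1 h2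
      _ = 2 ^ (L + M + N) := by
          push_cast
          rw [← pow_add]
          congr 1
          omega
  · simp

/-! ## Power series over `ℤ[x]`: `(1 - xt)^{-k}` and `(1 - t)^{-k}` -/

/-- `(1 - t)^{-k}` as a power series in `t` over `ℤ[x]` (Mathlib `PowerSeries.invOneSubPow`).
[folklore] -/
def hser (k : ℕ) : PowerSeries ℤ[X] := (PowerSeries.invOneSubPow ℤ[X] k).val

/-- `(1 - xt)^{-k}` as a power series in `t` over `ℤ[x]` (rescaling of `hser`). [folklore] -/
def gser (k : ℕ) : PowerSeries ℤ[X] := PowerSeries.rescale (X : ℤ[X]) (hser k)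

/-- `u = 1 - xt`. [folklore] -/
def u : PowerSeries ℤ[X] := 1 - PowerSeries.C (X : ℤ[X]) * PowerSeries.X

/-- `u = 1 - xt` is the rescaling of `1 - t`. [folklore] -/
theorem u_eq_rescale : u = PowerSeries.rescale (X : ℤ[X]) (1 - PowerSeries.X) := by
  rw [u, map_sub, map_one, PowerSeries.rescale_X]

/-- `(1 - t)^e (1 - t)^{-(d+e)} = (1 - t)^{-d}`. [folklore] -/
theorem one_sub_pow_mul_hser (d e : ℕ) : (1 - PowerSeries.X) ^ e * hser (d + e) = hser d :=
  PowerSeries.one_sub_pow_mul_invOneSubPow_val_add_eq_invOneSubPow_val ℤ[X] d e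

/-- `(1 - t)^{d+e} (1 - t)^{-e} = (1 - t)^d`. [folklore] -/
theorem one_sub_pow_add_mul_hser (d e : ℕ) :
    (1 - PowerSeries.X) ^ (d + e) * hser e = (1 - PowerSeries.X) ^ d :=
  PowerSeries.one_sub_pow_add_mul_invOneSubPow_val_eq_one_sub_pow ℤ[X] d e

/-- `(1 - xt)^e (1 - xt)^{-(d+e)} = (1 - xt)^{-d}`. [folklore] -/
theorem u_pow_mul_gser (d e : ℕ) : u ^ e * gser (d + e) = gser d := by
  rw [u_eq_rescale, gser, gser, ← map_pow, ← map_mul, one_sub_pow_mul_hser]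

/-- `(1 - xt)^{d+e} (1 - xt)^{-e} = (1 - xt)^d`. [folklore] -/
theorem u_pow_add_mul_gser (d e : ℕ) : u ^ (d + e) * gser e = u ^ d := by
  rw [u_eq_rescale, gser, ← map_pow, ← map_mul, one_sub_pow_add_mul_hser, map_pow]

/-- Coefficients of `(1 - t)^j`: `(-1)^b C(j, b)`. [folklore] -/
theorem coeff_one_sub_pow {S : Type*} [CommRing S] (j b : ℕ) :
    PowerSeries.coeff b ((1 - PowerSeries.X : PowerSeries S) ^ j) = (-1) ^ b * (j.choose b : S) := by
  induction j generalizing b with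
  | zero => cases b <;> simp
  | succ j ih =>
    rw [pow_succ, mul_sub, mul_one, map_sub]
    cases b with
    | zero => simp [ih]
    | succ b =>
      rw [PowerSeries.coeff_succ_mul_X, ih, ih, Nat.choose_succ_succ, Nat.cast_add, pow_succ]
      ring

/-- Coefficients of `(1 - t)^{-(k+1)}`: `C(k+b, k)`. [folklore] -/
theorem coeff_hser_succ (k b : ℕ) :
    PowerSeries.coeff b (hser (k + 1)) = (((k + b).choose k : ℕ) : ℤ[X]) := by
  rw [hser, PowerSeries.invOneSubPow_val_succ_eq_mk_add_choose, PowerSeries.coeff_mk]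

/-- Coefficients of `(1 - xt)^{-(k+1)}`: `C(k+a, k) xᵃ`. [folklore] -/
theorem coeff_gser_succ (k a : ℕ) :
    PowerSeries.coeff a (gser (k + 1)) = X ^ a * (((k + a).choose k : ℕ) : ℤ[X]) := by
  rw [gser, PowerSeries.coeff_rescale, coeff_hser_succ]

/-- Coefficients of `(1 - xt)^k`: `(-1)^a C(k, a) xᵃ`. [folklore] -/
theorem coeff_u_pow (k a : ℕ) :
    PowerSeries.coeff a (u ^ k) = X ^ a * ((-1) ^ a * (k.choose a : ℤ[X])) := by
  rw [u_eq_rescale, ← map_pow, PowerSeries.coeff_rescale, coeff_one_sub_pow]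

/-- **`Q_{L,M,N}(x)` is the coefficient of `tᴹ` in `(1 - xt)^{-(N+1)} (1 - t)^{-(L+1)}`.**
[cite: BombieriGubler2006, Thm. 5.2.10 (proof, (5.4))] -/
theorem coeff_gser_mul_hser (L M N : ℕ) :
    PowerSeries.coeff M (gser (N + 1) * hser (L + 1)) = Q L M N := by
  rw [PowerSeries.coeff_mul, Q]
  refine Finset.sum_congr rfl fun p _ => ?_
  rw [coeff_gser_succ, coeff_hser_succ, Nat.cast_mul, map_mul, map_natCast, map_natCast]
  ring


/-! ## The binomial expansion of `(1 - x)^{L+N+1}` as `((1 - xt) - x(1 - t))^{L+N+1}` -/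

/-- `w = x(1 - t)`. [folklore] -/
def w : PowerSeries ℤ[X] := PowerSeries.C (X : ℤ[X]) * (1 - PowerSeries.X)

/-- `1 - x = (1 - xt) - x(1 - t)` as constant power series in `t`. [folklore] -/
theorem C_one_sub_X_eq_u_sub_w : PowerSeries.C (1 - X : ℤ[X]) = u - w := by
  simp only [u, w, map_sub, map_one]
  ring

/-- The `i`-th term of the binomial expansion of `(1-x)^{L+N+1} (1-xt)^{-(N+1)} (1-t)^{-(L+1)}`:
`C(m, i) (1-xt)^i (-x(1-t))^{m-i} (1-xt)^{-(N+1)} (1-t)^{-(L+1)}`, `m = L+N+1`. [folklore] -/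
def term (L N i : ℕ) : PowerSeries ℤ[X] :=
  u ^ i * (-w) ^ (L + N + 1 - i) * ((L + N + 1).choose i : PowerSeries ℤ[X]) *
    (gser (N + 1) * hser (L + 1))

/-- **`F = (1-x)^{L+N+1} Q_{L,M,N}` is the sum of the `tᴹ`-coefficients of the terms.**
[folklore] -/
theorem F_eq_sum_coeff_term (L M N : ℕ) :
    F L M N = ∑ i ∈ range (L + N + 1 + 1), PowerSeries.coeff M (term L N i) := by
  have h : PowerSeries.C ((1 - X : ℤ[X]) ^ (L + N + 1)) * (gser (N + 1) * hser (L + 1)) =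
      ∑ i ∈ range (L + N + 1 + 1), term L N i := by
    rw [map_pow, C_one_sub_X_eq_u_sub_w, sub_eq_add_neg, add_pow, Finset.sum_mul]
    rfl
  have h' := congrArg (PowerSeries.coeff M) h
  rw [PowerSeries.coeff_C_mul, coeff_gser_mul_hser, map_sum] at h'
  rw [F, h']

/-- The integer coefficients of the monomials making up `coeff_M (term i)`. [folklore] -/
def termCoeff (L N i : ℕ) (p : ℕ × ℕ) : ℤ :=
  if i ≤ N then
    (L + N + 1).choose i * (-1) ^ (L + N + 1 - i) * ((N - i + p.1).choose (N - i)) *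
      ((-1) ^ p.2 * ((N - i).choose p.2))
  else
    (L + N + 1).choose i * (-1) ^ (L + N + 1 - i) * ((-1) ^ p.1 * ((i - N - 1).choose p.1)) *
      ((i - N - 1 + p.2).choose (i - N - 1))

/-- **The `tᴹ`-coefficient of the `i`-th term is `∑_{a+b=M} termCoeff(i, (a,b)) x^{m-i+a}`**
(after cancelling `(1-xt)^i` against `(1-xt)^{-(N+1)}` and `(1-t)^{m-i}` against
`(1-t)^{-(L+1)}`). [folklore] -/
theorem coeff_term (L M N i : ℕ) (hi : i ≤ L + N + 1) :
    PowerSeries.coeff M (term L N i) =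
      ∑ p ∈ antidiagonal M, C (termCoeff L N i p) * X ^ (L + N + 1 - i + p.1) := by
  have hterm : term L N i = PowerSeries.C ((((L + N + 1).choose i : ℕ) : ℤ[X]) *
      (-1) ^ (L + N + 1 - i) * X ^ (L + N + 1 - i)) *
      ((u ^ i * gser (N + 1)) * ((1 - PowerSeries.X) ^ (L + N + 1 - i) * hser (L + 1))) := by
    rw [term, w, neg_pow, mul_pow, map_mul, map_mul, map_natCast, map_pow, map_pow, map_neg,
      map_one]
    ring
  rw [hterm, PowerSeries.coeff_C_mul]
  by_cases hiN : i ≤ N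
  · -- `i ≤ N`: write `N + 1 = (N - i + 1) + i` and `m - i = (N - i) + (L + 1)`
    obtain ⟨j, rfl⟩ := Nat.exists_eq_add_of_le hiN
    have h1 : u ^ i * gser (i + j + 1) = gser (j + 1) := by
      rw [show i + j + 1 = (j + 1) + i by ring]; exact u_pow_mul_gser (j + 1) i
    have h2 : (1 - PowerSeries.X) ^ (L + (i + j) + 1 - i) * hser (L + 1) =
        (1 - PowerSeries.X) ^ j := by
      rw [show L + (i + j) + 1 - i = j + (L + 1) by omega]; exact one_sub_pow_add_mul_hser j (L + 1)
    rw [h1, h2, PowerSeries.coeff_mul, Finset.mul_sum]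
    refine Finset.sum_congr rfl fun p hp => ?_
    rw [coeff_gser_succ, coeff_one_sub_pow, termCoeff, if_pos hiN]
    simp only [show i + j - i = j by omega, map_mul, map_pow, map_neg, map_one, map_natCast]
    ring
  · -- `N < i`: write `i = k + (N + 1)` and `L + 1 = (k + 1) + (m - i)`
    rw [not_le] at hiN
    obtain ⟨k, rfl⟩ := Nat.exists_eq_add_of_lt hiN
    have h1 : u ^ (N + k + 1) * gser (N + 1) = u ^ k := by
      rw [show N + k + 1 = k + (N + 1) by ring]; exact u_pow_add_mul_gser k (N + 1)
    have h2 : (1 - PowerSeries.X) ^ (L + N + 1 - (N + k + 1)) * hser (L + 1) = hser (k + 1) := by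
      rw [show L + 1 = (k + 1) + (L + N + 1 - (N + k + 1)) by omega]
      exact one_sub_pow_mul_hser (k + 1) _
    rw [h1, h2, PowerSeries.coeff_mul, Finset.mul_sum]
    refine Finset.sum_congr rfl fun p hp => ?_
    rw [coeff_u_pow, coeff_hser_succ, termCoeff, if_neg (by omega)]
    simp only [show N + k + 1 - N - 1 = k by omega, map_mul, map_pow, map_neg, map_one,
      map_natCast]
    ring

/-- For `i ≤ N`, every monomial of `coeff_M (term i)` has degree `≥ L+M+1`: the coefficients of
`x^d`, `d ≤ L+M`, vanish. [folklore] -/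
theorem coeff_coeff_term_eq_zero_of_le {L M N i : ℕ} (hiN : i ≤ N) {d : ℕ} (hd : d < L + M + 1) :
    (PowerSeries.coeff M (term L N i)).coeff d = 0 := by
  rw [coeff_term L M N i (by omega), finsetSum_coeff]
  refine Finset.sum_eq_zero fun p hp => ?_
  rw [coeff_C_mul_X_pow]
  split_ifs with h
  · -- `d = m - i + p.1` forces `p.2 > N - i`, so the binomial coefficient vanishes
    have hp' : p.1 + p.2 = M := mem_antidiagonal.mp hp
    rw [termCoeff, if_pos hiN, Nat.choose_eq_zero_of_lt (by omega : N - i < p.2)]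
    simp
  · rfl

/-- For `i ≤ N`, the coefficient of `x^{L+M+1}` in `coeff_M (term i)` is
`(-1)^{L+1} C(m, i) C(M, N-i)`. [folklore] -/
theorem coeff_coeff_term_succ_of_le {L M N i : ℕ} (hiN : i ≤ N) :
    (PowerSeries.coeff M (term L N i)).coeff (L + M + 1) =
      (-1) ^ (L + 1) * ((L + N + 1).choose i * M.choose (N - i) : ℕ) := by
  rw [coeff_term L M N i (by omega), finsetSum_coeff]
  simp only [coeff_C_mul_X_pow]
  by_cases hjM : N - i ≤ M
  · -- the unique contributing index is `p = (M - (N - i), N - i)`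
    rw [Finset.sum_eq_single (M - (N - i), N - i)]
    · rw [if_pos (by omega), termCoeff, if_pos hiN]
      simp only [show N - i + (M - (N - i)) = M by omega, Nat.choose_self, Nat.cast_one,
        mul_one, Nat.cast_mul]
      have hs : (-1 : ℤ) ^ (L + N + 1 - i) * (-1) ^ (N - i) = (-1) ^ (L + 1) := by
        rw [← pow_add, show L + N + 1 - i + (N - i) = (L + 1) + 2 * (N - i) by omega, pow_add,
          pow_mul]
        simp
      calc _ = (((L + N + 1).choose i : ℕ) : ℤ) * ((M.choose (N - i) : ℕ) : ℤ) *
            ((-1 : ℤ) ^ (L + N + 1 - i) * (-1) ^ (N - i)) := by ring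
        _ = _ := by rw [hs]; ring
    · intro p hp hne
      rw [if_neg]
      intro hd
      have hp' : p.1 + p.2 = M := mem_antidiagonal.mp hp
      apply hne
      ext <;> simp <;> omega
    · intro h
      exact absurd (mem_antidiagonal.mpr (by omega)) h
  · -- `N - i > M`: no contribution, and `C(M, N-i) = 0`
    rw [not_le] at hjM
    rw [Nat.choose_eq_zero_of_lt hjM, mul_zero, Nat.cast_zero, mul_zero]
    refine Finset.sum_eq_zero fun p hp => ?_
    have hp' : p.1 + p.2 = M := mem_antidiagonal.mp hp
    rw [if_neg (by omega)]

/-- For `i > N`, `coeff_M (term i)` has degree `≤ L`. [folklore] -/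
theorem natDegree_coeff_term_le_of_lt {L M N i : ℕ} (hiN : N < i) (hi : i ≤ L + N + 1) :
    (PowerSeries.coeff M (term L N i)).natDegree ≤ L := by
  rw [coeff_term L M N i hi]
  refine (natDegree_sum_le _ _).trans (Finset.sup_le fun p hp => ?_)
  show (C (termCoeff L N i p) * X ^ (L + N + 1 - i + p.1)).natDegree ≤ L
  by_cases hpk : p.1 ≤ i - N - 1
  · exact (natDegree_C_mul_X_pow_le _ _).trans (by omega)
  · have h0 : termCoeff L N i p = 0 := by
      rw [termCoeff, if_neg (by omega), Nat.choose_eq_zero_of_lt (by omega : i - N - 1 < p.1)]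
      simp
    rw [h0, map_zero, zero_mul]
    exact (natDegree_zero.le).trans (Nat.zero_le _)

/-- **The Padé property** (B–G Thm. 5.2.10, identity (5.2)): the coefficients of `xᵏ`,
`L < k ≤ L+M`, in `(1-x)^{L+N+1} Q_{L,M,N}(x)` vanish. [cite: BombieriGubler2006, Thm. 5.2.10] -/
theorem coeff_F_eq_zero {L M N k : ℕ} (h1 : L < k) (h2 : k ≤ L + M) : (F L M N).coeff k = 0 := by
  rw [F_eq_sum_coeff_term, finsetSum_coeff]
  refine Finset.sum_eq_zero fun i hi => ?_
  have hi' : i ≤ L + N + 1 := Nat.lt_succ_iff.mp (mem_range.mp hi)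
  by_cases hiN : i ≤ N
  · exact coeff_coeff_term_eq_zero_of_le hiN (by omega)
  · exact coeff_eq_zero_of_natDegree_lt
      ((natDegree_coeff_term_le_of_lt (not_le.mp hiN) hi').trans_lt h1)

/-- **The exact order**: the coefficient of `x^{L+M+1}` in `(1-x)^{L+N+1} Q_{L,M,N}(x)` is
`(-1)^{L+1} C(L+M+N+1, N)` (Vandermonde), i.e. `R_{L,M,N}(0) = ± C(L+M+N+1, N) ≠ 0` in
B–G Thm. 5.2.10. [cite: BombieriGubler2006, Thm. 5.2.10] -/
theorem coeff_F_succ (L M N : ℕ) :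
    (F L M N).coeff (L + M + 1) = (-1) ^ (L + 1) * ((L + M + N + 1).choose N : ℕ) := by
  rw [F_eq_sum_coeff_term, finsetSum_coeff, show L + N + 1 + 1 = (N + 1) + (L + 1) by ring,
    Finset.sum_range_add]
  have htail : ∑ k ∈ range (L + 1),
      (PowerSeries.coeff M (term L N (N + 1 + k))).coeff (L + M + 1) = 0 := by
    refine Finset.sum_eq_zero fun k hk => coeff_eq_zero_of_natDegree_lt ?_
    have hk' : k ≤ L := Nat.lt_succ_iff.mp (mem_range.mp hk)
    exact (natDegree_coeff_term_le_of_lt (by omega) (by omega)).trans_lt (by omega)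
  rw [htail, add_zero, show L + M + N + 1 = (L + N + 1) + M by ring, Nat.add_choose_eq,
    Nat.sum_antidiagonal_eq_sum_range_succ_mk, Nat.cast_sum, Finset.mul_sum]
  refine Finset.sum_congr rfl fun i hi => ?_
  have hiN : i ≤ N := Nat.lt_succ_iff.mp (mem_range.mp hi)
  rw [coeff_coeff_term_succ_of_le hiN]

/-- `F` has degree at most `L+M+N+1`. [folklore] -/
theorem natDegree_F_le (L M N : ℕ) : (F L M N).natDegree ≤ L + M + N + 1 := by
  refine (natDegree_mul_le).trans ?_
  have h1 : ((1 - X : ℤ[X]) ^ (L + N + 1)).natDegree ≤ L + N + 1 := by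
    refine (natDegree_pow_le).trans ?_
    have : (1 - X : ℤ[X]).natDegree ≤ 1 := by
      rw [sub_eq_add_neg, ← C_1]
      exact (natDegree_add_le _ _).trans (by simp)
    exact (Nat.mul_le_mul_left _ this).trans (by omega)
  have h2 := natDegree_Q_le L M N
  omega

/-! ## `P`, `R` and the identity `(1-x)^{L+N+1} Q = P + x^{L+M+1} R` -/

/-- `P_{L,M,N}`: the part of degree `≤ L` of `(1-x)^{L+N+1} Q_{L,M,N}` (the numerator of the Padé
approximant; B–G's `P_{L,M,N}` up to the sign convention `P - (1-x)^{L+N+1}Q = x^{L+M+1}R` there,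
`(1-x)^{L+N+1}Q = P + x^{L+M+1}R` here). [cite: BombieriGubler2006, Thm. 5.2.10] -/
def P (L M N : ℕ) : ℤ[X] := ∑ k ∈ range (L + 1), C ((F L M N).coeff k) * X ^ k

/-- `R_{L,M,N}`: the part of degree `≥ L+M+1` of `(1-x)^{L+N+1} Q_{L,M,N}`, divided by `x^{L+M+1}`
(B–G's remainder `R_{L,M,N}` up to sign). [cite: BombieriGubler2006, Thm. 5.2.10] -/
def R (L M N : ℕ) : ℤ[X] := ∑ k ∈ range (N + 1), C ((F L M N).coeff (L + M + 1 + k)) * X ^ k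

/-- Coefficients of `P`. [folklore] -/
theorem coeff_P (L M N k : ℕ) :
    (P L M N).coeff k = if k ≤ L then (F L M N).coeff k else 0 := by
  simp only [P, finsetSum_coeff, coeff_C_mul_X_pow]
  simp [Finset.sum_ite_eq]

/-- Coefficients of `R`. [folklore] -/
theorem coeff_R (L M N k : ℕ) :
    (R L M N).coeff k = if k ≤ N then (F L M N).coeff (L + M + 1 + k) else 0 := by
  simp only [R, finsetSum_coeff, coeff_C_mul_X_pow]
  simp [Finset.sum_ite_eq]

/-- `deg P ≤ L`. [cite: BombieriGubler2006, Thm. 5.2.10] -/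
theorem natDegree_P_le (L M N : ℕ) : (P L M N).natDegree ≤ L := by
  refine (natDegree_sum_le _ _).trans (Finset.sup_le fun k hk => ?_)
  exact (natDegree_C_mul_X_pow_le _ _).trans (Nat.lt_succ_iff.mp (mem_range.mp hk))

/-- `deg R ≤ N`. [cite: BombieriGubler2006, Thm. 5.2.10] -/
theorem natDegree_R_le (L M N : ℕ) : (R L M N).natDegree ≤ N := by
  refine (natDegree_sum_le _ _).trans (Finset.sup_le fun k hk => ?_)
  exact (natDegree_C_mul_X_pow_le _ _).trans (Nat.lt_succ_iff.mp (mem_range.mp hk))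

/-- **B–G Thm. 5.2.10, identity (5.2)** in the form `(1-x)^{L+N+1} Q_{L,M,N} = P + x^{L+M+1} R`
with `deg P ≤ L`, `deg R ≤ N`: `P/Q` is the `(L, M)`-Padé approximant of `(1-x)^{L+N+1}`.
[cite: BombieriGubler2006, Thm. 5.2.10] -/
theorem F_eq_P_add (L M N : ℕ) : F L M N = P L M N + X ^ (L + M + 1) * R L M N := by
  ext k
  rw [coeff_add, coeff_X_pow_mul', coeff_P, coeff_R]
  by_cases h1 : k ≤ L
  · rw [if_pos h1, if_neg (by omega), add_zero]
  rw [if_neg h1, zero_add]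
  by_cases h2 : k ≤ L + M
  · rw [if_neg (by omega), coeff_F_eq_zero (not_le.mp h1) h2]
  rw [if_pos (by omega)]
  by_cases h3 : k - (L + M + 1) ≤ N
  · rw [if_pos h3, show L + M + 1 + (k - (L + M + 1)) = k by omega]
  · rw [if_neg h3, coeff_eq_zero_of_natDegree_lt]
    exact (natDegree_F_le L M N).trans_lt (by omega)

/-- `R(0) = (-1)^{L+1} C(L+M+N+1, N)` — the approximation has exact order `L+M+1`
(B–G: `R_{L,M,N}` has "exact degree `N`" and does "not vanish at `0`").
[cite: BombieriGubler2006, Thm. 5.2.10] -/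
theorem R_eval_zero (L M N : ℕ) :
    (R L M N).eval 0 = (-1) ^ (L + 1) * ((L + M + N + 1).choose N : ℕ) := by
  rw [← coeff_zero_eq_eval_zero, coeff_R, if_pos (Nat.zero_le _), add_zero, coeff_F_succ]

/-- `R(0) ≠ 0`. [cite: BombieriGubler2006, Thm. 5.2.10] -/
theorem R_eval_zero_ne_zero (L M N : ℕ) : (R L M N).eval 0 ≠ 0 := by
  rw [R_eval_zero]
  exact mul_ne_zero (pow_ne_zero _ (by norm_num))
    (Nat.cast_ne_zero.mpr (Nat.choose_pos (by omega)).ne')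

/-- `P(0) = Q(0) = C(L+M, L)`. [cite: BombieriGubler2006, Thm. 5.2.10] -/
theorem P_eval_zero (L M N : ℕ) : (P L M N).eval 0 = ((L + M).choose L : ℤ) := by
  rw [← coeff_zero_eq_eval_zero, coeff_P, if_pos (Nat.zero_le _), F, coeff_zero_eq_eval_zero,
    eval_mul, eval_pow, Q_eval_zero]
  simp

/-! ## Coefficient bounds -/

/-- Coefficients of `(1 - x)^m ∈ ℤ[x]`: `(-1)^a C(m, a)`. [folklore] -/
theorem coeff_one_sub_X_pow (m a : ℕ) :
    ((1 - X : ℤ[X]) ^ m).coeff a = (-1) ^ a * (m.choose a : ℤ) := by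
  rw [← Polynomial.coeff_coe, Polynomial.coe_pow, Polynomial.coe_sub, Polynomial.coe_one,
    Polynomial.coe_X, coeff_one_sub_pow]

/-- Partial sums of a row of Pascal's triangle are at most `2^m`. [folklore] -/
theorem sum_range_choose_le (m k : ℕ) : ∑ a ∈ range (k + 1), m.choose a ≤ 2 ^ m := by
  calc ∑ a ∈ range (k + 1), m.choose a ≤ ∑ a ∈ range (m + 1 + (k + 1)), m.choose a :=
        Finset.sum_le_sum_of_subset (range_subset_range.mpr (by omega))
    _ = 2 ^ m := by
        rw [Finset.sum_range_add, Nat.sum_range_choose, Finset.sum_eq_zero, add_zero]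
        exact fun a _ => Nat.choose_eq_zero_of_lt (by omega)

/-- **Crude single-exponential coefficient bound**: every coefficient of
`F = (1-x)^{L+N+1} Q_{L,M,N}` (hence of `P` and `R`) is at most `2^{L+N+1} · 2^{L+M+N}` in absolute
value (B–G record the exact `ℓ¹`-norms `C(L+M+N+1, ·)`; any bound `c^{L+M+N}` serves Lemma 5.2.14).
[folklore] -/
theorem abs_coeff_F_le (L M N k : ℕ) :
    |(F L M N).coeff k| ≤ 2 ^ (L + N + 1) * 2 ^ (L + M + N) := by
  rw [F, coeff_mul]
  refine (Finset.abs_sum_le_sum_abs _ _).trans ?_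
  calc ∑ p ∈ antidiagonal k, |((1 - X : ℤ[X]) ^ (L + N + 1)).coeff p.1 * (Q L M N).coeff p.2|
      ≤ ∑ p ∈ antidiagonal k, (((L + N + 1).choose p.1 : ℕ) : ℤ) * 2 ^ (L + M + N) := by
        refine Finset.sum_le_sum fun p _ => ?_
        rw [abs_mul, coeff_one_sub_X_pow, abs_mul, abs_pow, abs_neg, abs_one, one_pow, one_mul,
          Nat.abs_cast]
        exact mul_le_mul_of_nonneg_left (abs_coeff_Q_le L M N _) (Nat.cast_nonneg _)
    _ = (∑ p ∈ antidiagonal k, (((L + N + 1).choose p.1 : ℕ) : ℤ)) * 2 ^ (L + M + N) := by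
        rw [Finset.sum_mul]
    _ ≤ 2 ^ (L + N + 1) * 2 ^ (L + M + N) := by
        refine mul_le_mul_of_nonneg_right ?_ (by positivity)
        rw [Nat.sum_antidiagonal_eq_sum_range_succ_mk]
        exact_mod_cast sum_range_choose_le (L + N + 1) k

/-- Coefficient bound for `P`. [folklore] -/
theorem abs_coeff_P_le (L M N k : ℕ) :
    |(P L M N).coeff k| ≤ 2 ^ (L + N + 1) * 2 ^ (L + M + N) := by
  rw [coeff_P]
  split_ifs
  · exact abs_coeff_F_le L M N k
  · rw [abs_zero]; positivity

/-- Coefficient bound for `R`. [folklore] -/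
theorem abs_coeff_R_le (L M N k : ℕ) :
    |(R L M N).coeff k| ≤ 2 ^ (L + N + 1) * 2 ^ (L + M + N) := by
  rw [coeff_R]
  split_ifs
  · exact abs_coeff_F_le L M N _
  · rw [abs_zero]; positivity

/-! ## Non-proportionality of consecutive approximants (replaces B–G Prop. 5.2.11) -/

/-- **The consecutive-`L` determinant**: for `L ≥ 1`,
`P_L Q_{L-1} - (1-x) P_{L-1} Q_L = R_{L-1}(0) Q_L(0) · x^{L+M}` (all with the same `M, N`).
Proof: substituting `P = (1-x)^m Q - x^{L+M+1} R` the `Q_L Q_{L-1}` terms cancel, leaving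
`x^{L+M} ((1-x) R_{L-1} Q_L - x R_L Q_{L-1})`, a polynomial of degree `≤ L+M`; so the bracket is
constant, equal to its value at `0`. (An elementary substitute for B–G Prop. 5.2.11, which uses
the Riemann–Hurwitz formula.) [folklore] -/
theorem P_mul_Q_sub (L M N : ℕ) (hL : 1 ≤ L) :
    P L M N * Q (L - 1) M N - (1 - X) * P (L - 1) M N * Q L M N =
      C ((R (L - 1) M N).eval 0 * (Q L M N).eval 0) * X ^ (L + M) := by
  set G : ℤ[X] := (1 - X) * R (L - 1) M N * Q L M N - X * R L M N * Q (L - 1) M N with hG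
  have hPL : P L M N = (1 - X) ^ (L + N + 1) * Q L M N - X ^ (L + M + 1) * R L M N := by
    rw [← F, F_eq_P_add]; ring
  have hPL' : P (L - 1) M N =
      (1 - X) ^ (L + N) * Q (L - 1) M N - X ^ (L + M) * R (L - 1) M N := by
    have h := F_eq_P_add (L - 1) M N
    rw [F, show L - 1 + N + 1 = L + N by omega, show L - 1 + M + 1 = L + M by omega] at h
    rw [h]; ring
  have hE : P L M N * Q (L - 1) M N - (1 - X) * P (L - 1) M N * Q L M N = X ^ (L + M) * G := by
    rw [hPL, hPL', hG, pow_succ, pow_succ]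
    ring
  -- degree of the left-hand side is at most `L + M`
  have hdeg : (X ^ (L + M) * G).natDegree ≤ L + M := by
    rw [← hE]
    refine (natDegree_sub_le _ _).trans (max_le ?_ ?_)
    · refine natDegree_mul_le.trans ?_
      have h1 := natDegree_P_le L M N
      have h2 := natDegree_Q_le (L - 1) M N
      omega
    · refine natDegree_mul_le.trans ?_
      have h1 : ((1 - X : ℤ[X]) * P (L - 1) M N).natDegree ≤ L := by
        refine natDegree_mul_le.trans ?_
        have h3 : (1 - X : ℤ[X]).natDegree ≤ 1 := by
          rw [sub_eq_add_neg, ← C_1]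
          exact (natDegree_add_le _ _).trans (by simp)
        have h4 := natDegree_P_le (L - 1) M N
        omega
      have h2 := natDegree_Q_le L M N
      omega
  -- hence `G` is constant
  have hGc : G = C (G.coeff 0) := by
    by_cases hG0 : G = 0
    · rw [hG0]; simp
    · refine eq_C_of_natDegree_eq_zero ?_
      have h := natDegree_mul (pow_ne_zero (L + M) X_ne_zero : (X : ℤ[X]) ^ (L + M) ≠ 0) hG0
      rw [natDegree_X_pow] at h
      omega
  have hG0 : G.coeff 0 = (R (L - 1) M N).eval 0 * (Q L M N).eval 0 := by
    simp only [hG, coeff_zero_eq_eval_zero, eval_mul, eval_sub, eval_one, eval_X]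
    ring
  rw [hE, hGc, hG0, mul_comm]

/-- **Non-proportionality** (the dichotomy "either `C(L,M,N)` or `C(L-1,M,N)` holds" in the proof
of B–G Lemma 5.2.14, p. 134): in a field of characteristic zero, for `x₁ ≠ 0`, `x₁ + x₂ = 1` and
`y₂ ≠ 0`, the two relations `y₂ P_L(x₁) = x₂^{L+N+1} Q_L(x₁)` and
`y₂ P_{L-1}(x₁) = x₂^{L+N} Q_{L-1}(x₁)` cannot both hold (`L ≥ 1`).
[cite: BombieriGubler2006, Lemma 5.2.14 (proof)] -/
theorem not_and_of_consecutive {K : Type*} [Field K] [CharZero K] {L M N : ℕ} (hL : 1 ≤ L)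
    {x₁ x₂ y₂ : K} (hx : x₁ + x₂ = 1) (hx₁ : x₁ ≠ 0) (hy₂ : y₂ ≠ 0) :
    ¬ (y₂ * aeval x₁ (P L M N) = x₂ ^ (L + N + 1) * aeval x₁ (Q L M N) ∧
        y₂ * aeval x₁ (P (L - 1) M N) = x₂ ^ (L + N) * aeval x₁ (Q (L - 1) M N)) := by
  rintro ⟨h1, h2⟩
  have hid := congrArg (aeval x₁) (P_mul_Q_sub L M N hL)
  simp only [map_sub, map_mul, aeval_one, aeval_X, map_pow, eq_intCast, map_intCast] at hid
  have hx₂ : (1 : K) - x₁ = x₂ := by rw [← hx]; ring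
  rw [hx₂] at hid
  -- multiply the identity by `y₂` and use the two relations
  have key : y₂ * (aeval x₁ (P L M N) * aeval x₁ (Q (L - 1) M N) -
      x₂ * aeval x₁ (P (L - 1) M N) * aeval x₁ (Q L M N)) = 0 := by
    have e1 : y₂ * (aeval x₁ (P L M N) * aeval x₁ (Q (L - 1) M N)) =
        x₂ ^ (L + N + 1) * aeval x₁ (Q L M N) * aeval x₁ (Q (L - 1) M N) := by
      rw [← mul_assoc, h1]
    have e2 : y₂ * (x₂ * aeval x₁ (P (L - 1) M N) * aeval x₁ (Q L M N)) =
        x₂ ^ (L + N + 1) * aeval x₁ (Q (L - 1) M N) * aeval x₁ (Q L M N) := by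
      rw [show y₂ * (x₂ * aeval x₁ (P (L - 1) M N) * aeval x₁ (Q L M N)) =
        x₂ * (y₂ * aeval x₁ (P (L - 1) M N)) * aeval x₁ (Q L M N) by ring, h2]
      ring
    rw [mul_sub, e1, e2]
    ring
  rw [hid, mul_eq_zero] at key
  rcases key with h | h
  · exact hy₂ h
  · rw [mul_eq_zero] at h
    rcases h with h | h
    · have hc : ((R (L - 1) M N).eval 0 * (Q L M N).eval 0 : ℤ) ≠ 0 :=
        mul_ne_zero (R_eval_zero_ne_zero _ _ _) (by
          rw [Q_eval_zero]; exact Nat.cast_ne_zero.mpr (Nat.choose_pos (by omega)).ne')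
      exact hc (by exact_mod_cast h)
    · exact hx₁ (pow_eq_zero_iff (by omega) |>.mp h)

/-- The Padé identity evaluated at a point: if `x₁ + x₂ = 1` then
`x₂^{L+N+1} Q(x₁) = P(x₁) + x₁^{L+M+1} R(x₁)`. [cite: BombieriGubler2006, Thm. 5.2.10] -/
theorem aeval_identity {K : Type*} [CommRing K] (L M N : ℕ) {x₁ x₂ : K} (hx : x₁ + x₂ = 1) :
    x₂ ^ (L + N + 1) * aeval x₁ (Q L M N) =
      aeval x₁ (P L M N) + x₁ ^ (L + M + 1) * aeval x₁ (R L M N) := by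
  have h := congrArg (aeval x₁) (F_eq_P_add L M N)
  simp only [F, map_add, map_mul, map_pow, map_sub, aeval_one, aeval_X] at h
  rwa [show (1 : K) - x₁ = x₂ by rw [← hx]; ring] at h

end Pade

end Literature.NumberTheory.DiophantineGeometry

end
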